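import Summits.ValiantsHypothesis.ValiantsHypothesis.Theses.LacunarySymmetroid
import Summits.ValiantsHypothesis.ValiantsHypothesis.Theorems.LacunarySymmetroidMatrixDescartesDoorA26NullEndExtension

/-!
# `DoorA26` is FALSE modulo NULL-NULL EIGHTEEN: a `(2,6)` pencil whose two end letters are NULL and whose determinant alternates 19 times yields a TWENTY

HONEST FRAMING.  Crux `Theses.LacunarySymmetroid.DoorA26` (stmt-ValiantsHypothesis-19979; OPEN, typed, never asserted); W2 seat val-sym-door-p1 g16.
This is a NEGATIVE-SIDE reduction «modulo H» in the sense of the `Theorems/DoorA26/Negative/` convention (cf. `DoorA26FalseOfTenTouches`): the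
construction item `NullNullEighteen` below is NOT asserted anywhere — it is a TARGET SHAPE for the object search.  Nothing here bears on
`MatrixDescartes` (stmt-ValiantsHypothesis-18050) or `VP ≠ VNP`; registers `ζ_sym(2,6) ∈ {18,19,20}` unchanged.

THE REDUCTION (`twenty_of_nullNullEighteen`, `doorA26_false_of_nullNullEighteen`).  Let `P(t) = Σ_l t^{d_l} S_l` be a real symmetric `2 × 2` pencil with
STRICTLY increasing exponents whose lowest and highest letters are NULL and non-zero (`det S₀ = det S₅ = 0`, `tr S₀, tr S₅ ≠ 0`) and whose determinant takes
strictly alternating signs at `19` increasing positive abscissae (so `det P` has `18` positive zeros).  Replace `S₅` by `S₅ + η·1`: `det(S₅ + η·1) =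
η·tr S₅ + η²` has the sign of `η·tr S₅` for small `η`, the 19 signs persist for small `η` (continuity), and for `t → ∞` the sign of `det P_η(t)` is that of
`det(S₅ + η·1)` (the top exponent `2d₅` is strict) — choosing the sign of `η` gives a 20th alternating abscissa; the same at the bottom letter (`t → 0⁺`,
exponent `2d₀` strictly lowest) gives a 21st.  Hence `20` distinct positive roots (`le_card_posRoots_of_alternating`) and `¬ DoorA26`.
WHY THIS SHAPE (located, W2 g16 memo `DOOR-A26-P1G16-TWO-SLOPE-LINKING.md` §8–§9): at generic support the multi-cluster degenerations of twenties that
survive the signed two-slope law are END profiles — a zero splits off at an end scale, leaving the end letter NULL in the main cluster's limit; the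
record eighteen `Census.M2K6G18` has exactly this architecture with both end letters (near-)null but only 16 zeros on the 19 inner values.  So the object
search may restrict to the null-null class (two parameters fewer per end letter) and aim at 19 ALTERNATIONS there: that is a twenty.

[folklore] continuity and leading-term asymptotics of polynomials; [this work] the reduction.
-/

-- `Summit.ValiantsHypothesis.ValiantsHypothesis.…` repeats a component by the D-0017 layout
-- (single-conjunct summit), which the `dupNamespace` linter flags; the name is mandated.
set_option linter.dupNamespace false

namespace Summit.ValiantsHypothesis.ValiantsHypothesis.Theorems.DoorA26.Negative

open Polynomial Finset Filter Topology
open scoped BigOperators Matrix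
open Summit.ValiantsHypothesis.ValiantsHypothesis.Theorems.SymmetroidDescartes (eval_det_pencil le_card_posRoots_of_alternating)
open Summit.ValiantsHypothesis.ValiantsHypothesis.Theorems.LacunarySymmetroidMatrixDescartes.WallBubbling.Bubbling
  (polar polar_self det_sum_smul_fin_two)
open Summit.ValiantsHypothesis.ValiantsHypothesis.Theorems.LacunarySymmetroidMatrixDescartes.NullEnd

/-- **H (construction item) — NULL-NULL EIGHTEEN.**  A real symmetric `(2,6)` pencil with strictly increasing exponents, NULL non-zero end letters
(`det S₀ = det S₅ = 0`, `tr S₀ ≠ 0`, `tr S₅ ≠ 0`) and `19` increasing positive abscissae at which `det P` strictly alternates in sign (eighteen positive zeros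
on the `19` inner pair-sum values).  NOT asserted anywhere. [candidate construction of the cell; no citation exists] -/
def NullNullEighteen : Prop :=
  ∃ (d : Fin 6 → ℕ) (S : Fin 6 → Matrix (Fin 2) (Fin 2) ℝ) (τ : Fin 19 → ℝ),
    (∀ l, (S l).IsSymm) ∧ StrictMono d ∧
    (S 0).det = 0 ∧ (S 0).trace ≠ 0 ∧ (S 5).det = 0 ∧ (S 5).trace ≠ 0 ∧
    StrictMono τ ∧ (∀ j, 0 < τ j) ∧
    (∀ j : Fin 18, (∑ l, τ j.castSucc ^ d l • S l).det * (∑ l, τ j.succ ^ d l • S l).det < 0)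

/-! ### The reduction -/

/-- **NULL-NULL EIGHTEEN ⇒ TWENTY.**  Un-null the top letter, then the bottom letter: `21` alternating abscissae, hence `20` distinct positive roots of the
determinant of a real symmetric `(2,6)` pencil. [this work] -/
theorem twenty_of_nullNullEighteen (h : NullNullEighteen) :
    ∃ (d : Fin 6 → ℕ) (S : Fin 6 → Matrix (Fin 2) (Fin 2) ℝ), (∀ l, (S l).IsSymm) ∧
      20 ≤ ((∑ l, (X : ℝ[X]) ^ d l • (S l).map C).det.roots.toFinset.filter (fun t => 0 < t)).card := by
  obtain ⟨d, S, τ, hS, hd, h0, htr0, h5, htr5, hτ, hpos, halt⟩ := h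
  -- every abscissa carries a non-zero value
  have hne : ∀ j : Fin 19, (∑ l, τ j ^ d l • S l).det ≠ 0 := by
    intro j
    by_cases hj : j = Fin.last 18
    · subst hj
      have := halt (Fin.last 17)
      rw [Fin.succ_last] at this
      intro hz; rw [hz, mul_zero] at this; exact lt_irrefl _ this
    · obtain ⟨i, rfl⟩ := Fin.exists_castSucc_eq.mpr hj
      have := halt i
      intro hz; rw [hz, zero_mul] at this; exact lt_irrefl _ this
  -- un-null the top letter
  obtain ⟨η₁, τ₁, hτ₁, hpos₁, hne₁, halt₁⟩ := extend_top d hd S h5 htr5 τ hτ hpos hne halt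
  set S₁ := Function.update S 5 (S 5 + η₁ • (1 : Matrix (Fin 2) (Fin 2) ℝ)) with hS₁
  have hS₁0 : S₁ 0 = S 0 := by rw [hS₁, Function.update_of_ne (by decide)]
  have hS₁sym : ∀ l, (S₁ l).IsSymm := isSymm_update S hS 5 η₁
  -- un-null the bottom letter
  obtain ⟨η₂, τ₂, hτ₂, hpos₂, -, halt₂⟩ :=
    extend_bot d hd S₁ (by rw [hS₁0]; exact h0) (by rw [hS₁0]; exact htr0) τ₁ hτ₁ hpos₁ hne₁ halt₁
  set S₂ := Function.update S₁ 0 (S₁ 0 + η₂ • (1 : Matrix (Fin 2) (Fin 2) ℝ)) with hS₂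
  refine ⟨d, S₂, isSymm_update S₁ hS₁sym 0 η₂, ?_⟩
  refine le_card_posRoots_of_alternating _ 20 τ₂ hτ₂ hpos₂ fun j => ?_
  rw [eval_det_pencil, eval_det_pencil]
  exact halt₂ j

/-- **`DoorA26` is false modulo `NullNullEighteen`.** [this work] -/
theorem doorA26_false_of_nullNullEighteen (h : NullNullEighteen) :
    ¬ Summit.ValiantsHypothesis.ValiantsHypothesis.Theses.LacunarySymmetroid.DoorA26 := by
  intro hA
  obtain ⟨d, S, hS, h20⟩ := twenty_of_nullNullEighteen h
  have h19 := hA d S hS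
  omega

/-- Contrapositive, the positive reading: the door forbids a null-null eighteen — under `DoorA26` every real symmetric `(2,6)` pencil with strictly
increasing exponents and NULL non-zero end letters has at most `17` sign alternations of its determinant along any increasing positive sequence. [this work] -/
theorem not_nullNullEighteen_of_doorA26 (hA : Summit.ValiantsHypothesis.ValiantsHypothesis.Theses.LacunarySymmetroid.DoorA26) :
    ¬ NullNullEighteen :=
  fun h => doorA26_false_of_nullNullEighteen h hA

end Summit.ValiantsHypothesis.ValiantsHypothesis.Theorems.DoorA26.Negative
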